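/-
Copyright (c) 2026 the pub-hodgecm-mathlib formalisation cell (harness21).  Prover seat hodgecm-mathlib-K2E5-p16 (g4): Track B «K2-LIT»,
hLiu418 = stmt-HodgeConjecture-24832, LEAD F0P6-plan (g11) LAST DEALS 2026-09-04T05:45:00Z (1) «Φ6b-1» (in force under LEAD (g12)) =
ROAD Φ organ Φ6b-1 (Shimura's `ξ` on `Herm₂(ℂ)`), FIBRES file of the absolute-convergence kernel `|det(g + ix)|^{−σ}`; 2026-09-04.
-/
import Summits.HodgeConjecture.HodgeConjecture.Theorems.K2LiuHermTwoGammaDefs              -- ★ p857639: `hermTwo` + API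
import Mathlib.Analysis.SpecialFunctions.JapaneseBracket
import Mathlib.MeasureTheory.Measure.Haar.NormedSpace
import Mathlib.MeasureTheory.Integral.Prod
import Mathlib.LinearAlgebra.Complex.FiniteDimensional
import HarnessLib

/-!
# Crux `HLiu418`, ROAD Φ, organ Φ6b-1 — FIBRES of the kernel `|det(g + ix)|^{−σ}` on `Herm₂(ℂ)`
# (the absolute-convergence majorant of Shimura's confluent hypergeometric function `ξ(g, h; α, β)`, `σ = re(α+β)`)

Cell `hodgecm-mathlib`, crux item hLiu418 = `stmt-HodgeConjecture-24832`, route of record `HCCMUnconditional`; squad K2, LEAD F0P6-plan (g11 → g12)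
(LAST DEALS 05:45:00Z (1): «Φ6b-1 `…ConfluentXiDefs` + `…XiConvergence` — Fourier-side definition of Shimura's `ξ(y, h; α, β)` on `Herm₂(ℂ)`
with absolute convergence»), dealer K2E5-plan (g5) (CENSUS-41 row Φ6), prover K2E5-p16 (g4).  THEOREMS ONLY (no `def`, no instance, no
notation, no named-fact hypothesis, no `sorry`, default heartbeats); Mathlib + ★ DEFS leaf; lane `--supports stmt-HodgeConjecture-24832 --as helper`.

THE POINT (REPORT-FIRST 06:1xZ, correction (A)).  `ξ(g,h;α,β) = ∫_V e(−hx) det(x+ig)^{−α} det(x−ig)^{−β} dx` on `V = Herm₂(ℂ)` converges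
absolutely iff `J_σ(g) := ∫_V |det(g + ix)|^{−σ} dx < ∞`, `σ = re(α+β)`, and `J_σ(g) < ∞ ⟺ σ > 2κ − 1 = 3` (κ = 2).  This file computes the
fibres of `|det(g + ix)|^{−σ}` in the chart `x = hermTwo (a, z, b)`, `g = hermTwo (p, w, q) > 0`, by TRANSLATION and SCALING only:
* `det_hermTwo_add_I_smul_hermTwo` — `det(g + ix) = (det g − det x) + i·(pb + qa − 2 Re(w z̄))` (real and imaginary parts), and
  `normSq_det_hermTwo_add_I_smul` — THE KEY IDENTITY `|det(g + ix)|² = (a² + p²)·((b + μ)² + ν²)` with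
  `ν = (p‖z − (a/p)w‖² + (a²+p²) det g / p)/(a²+p²) > 0` (`nu_pos`) and an explicit real `μ` (Lagrange's identity);
* 1-D: `integrable_one_add_sq_rpow` (`C₁ = ∫_ℝ (1+t²)^{−σ/2} dt < ∞`, σ > 1, ★ `integrable_rpow_neg_one_add_norm_sq`),
  `integral_sq_add_sq_rpow` ∕ `integrable_sq_add_sq_rpow` (`∫_ℝ ((b+μ)²+ν²)^{−σ/2} db = ν^{1−σ} C₁`, ★ `integral_add_right_eq_self`,
  ★ `Measure.integral_comp_mul_left`), `integrable_sq_add_const_rpow` (`a ↦ (a²+p²)^{1−σ/2}` integrable for σ > 3);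
* 2-D: `integrable_one_add_norm_sq_rpow_complex` (`C₂ = ∫_ℂ (1+‖u‖²)^{1−σ} du < ∞`, σ > 2, `finrank ℝ ℂ = 2`),
  `integral_mul_norm_sub_sq_add_rpow` ∕ `integrable_mul_norm_sub_sq_add_rpow` (`∫_ℂ (p‖z−c₀‖²+K)^{1−σ} dz = K^{1−σ}(K/p) C₂`,
  ★ `integral_sub_right_eq_self`, ★ `Measure.integral_comp_smul`).
The assembly (`integrable_prod_iff` in the order b → z → a, head `Integrable (fun c => ‖det(g + I • hermTwo c)‖ ^ (−σ))` for `σ > 3`) is the file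
`K2LiuHermTwoDetPowerIntegrable.lean`; the `ξ`-definition and its domination are `K2LiuHermTwoConfluentXiDefs∕Convergence.lean`.

HONEST LABEL.  Count-neutral helper of the K2_Liu road; it pays no socket by itself: `HC_CM` is proved only modulo the 7 printed citations
(2 remaining named inputs: hLiu418 = `stmt-HodgeConjecture-24832`, h413 = `stmt-HodgeConjecture-24833`) until rung 0 closes.
References (orientation only): [Shimura1982] G. Shimura, Math. Ann. 260 (1982), §1 ((1.25)–(1.26): `ξ` and its convergence for `re(α+β) > 2κ−1`).
-/

set_option autoImplicit false
-- the mandated namespace repeats the single-problem summit's segment (`HodgeConjecture.HodgeConjecture`)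
set_option linter.dupNamespace false

noncomputable section

open Complex MeasureTheory Set
open scoped ComplexOrder ComplexConjugate

namespace Summit.HodgeConjecture.HodgeConjecture.Cruxes.HLiu418.K2LiuHermTwoDetPowerFibres

open Summit.HodgeConjecture.HodgeConjecture.Cruxes.HLiu418.K2LiuHermTwoGammaDefs

/-! ## One-dimensional translation–scaling lemmas -/

/-- `t ↦ (1 + t²)^{−σ/2}` is integrable on `ℝ` for `σ > 1` (so `C₁(σ) = ∫_ℝ (1+t²)^{−σ/2} dt` is a finite constant). -/
theorem integrable_one_add_sq_rpow {σ : ℝ} (hσ : 1 < σ) :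
    Integrable (fun t : ℝ => (1 + t ^ 2) ^ (-σ / 2)) := by
  have h := integrable_rpow_neg_one_add_norm_sq (E := ℝ) (μ := volume) (r := σ) (by simpa using hσ)
  refine h.congr (Filter.Eventually.of_forall fun t => ?_)
  simp [Real.norm_eq_abs, sq_abs]

/-- Scaling: `((ν t)² + ν²)^{−σ/2} = ν^{−σ} (1 + t²)^{−σ/2}` for `ν > 0`. -/
theorem sq_mul_add_sq_rpow {ν : ℝ} (hν : 0 < ν) (σ t : ℝ) :
    ((ν * t) ^ 2 + ν ^ 2) ^ (-σ / 2) = ν ^ (-σ) * (1 + t ^ 2) ^ (-σ / 2) := by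
  rw [show (ν * t) ^ 2 + ν ^ 2 = ν ^ 2 * (1 + t ^ 2) by ring, Real.mul_rpow (by positivity) (by positivity),
    show (ν ^ 2 : ℝ) = ν ^ (2 : ℝ) by norm_cast, ← Real.rpow_mul hν.le]
  congr 1
  ring

/-- `b ↦ ((b + μ)² + ν²)^{−σ/2}` is integrable on `ℝ` for `ν > 0`, `σ > 1`. -/
theorem integrable_sq_add_sq_rpow {ν : ℝ} (hν : 0 < ν) {σ : ℝ} (hσ : 1 < σ) (μ : ℝ) :
    Integrable (fun b : ℝ => ((b + μ) ^ 2 + ν ^ 2) ^ (-σ / 2)) := by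
  have h1 : Integrable (fun b : ℝ => (b ^ 2 + ν ^ 2) ^ (-σ / 2)) := by
    have h2 : Integrable (fun t : ℝ => (fun b : ℝ => (b ^ 2 + ν ^ 2) ^ (-σ / 2)) (ν * t)) := by
      have h3 : (fun t : ℝ => (fun b : ℝ => (b ^ 2 + ν ^ 2) ^ (-σ / 2)) (ν * t)) =
          fun t => ν ^ (-σ) * (1 + t ^ 2) ^ (-σ / 2) := funext fun t => sq_mul_add_sq_rpow hν σ t
      rw [h3]
      exact (integrable_one_add_sq_rpow hσ).const_mul _
    exact (integrable_comp_mul_left_iff (fun b : ℝ => (b ^ 2 + ν ^ 2) ^ (-σ / 2)) hν.ne').mp h2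
  exact h1.comp_add_right μ

/-- Translation + scaling: `∫_ℝ ((b + μ)² + ν²)^{−σ/2} db = ν^{1−σ} · ∫_ℝ (1 + t²)^{−σ/2} dt` (`ν > 0`). -/
theorem integral_sq_add_sq_rpow {ν : ℝ} (hν : 0 < ν) (σ μ : ℝ) :
    ∫ b : ℝ, ((b + μ) ^ 2 + ν ^ 2) ^ (-σ / 2) = ν ^ (1 - σ) * ∫ t : ℝ, (1 + t ^ 2) ^ (-σ / 2) := by
  have h1 : ∫ b : ℝ, ((b + μ) ^ 2 + ν ^ 2) ^ (-σ / 2) = ∫ b : ℝ, (b ^ 2 + ν ^ 2) ^ (-σ / 2) :=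
    integral_add_right_eq_self (fun b => (b ^ 2 + ν ^ 2) ^ (-σ / 2)) μ
  have h2 := Measure.integral_comp_mul_left (fun b : ℝ => (b ^ 2 + ν ^ 2) ^ (-σ / 2)) ν
  have h3 : (fun t : ℝ => (fun b : ℝ => (b ^ 2 + ν ^ 2) ^ (-σ / 2)) (ν * t)) =
      fun t => ν ^ (-σ) * (1 + t ^ 2) ^ (-σ / 2) := funext fun t => sq_mul_add_sq_rpow hν σ t
  rw [h3, integral_const_mul, abs_of_pos (inv_pos.mpr hν), smul_eq_mul] at h2
  rw [h1]
  have hν0 : ν ≠ 0 := hν.ne'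
  calc ∫ b : ℝ, (b ^ 2 + ν ^ 2) ^ (-σ / 2) = ν * (ν ^ (-σ) * ∫ t : ℝ, (1 + t ^ 2) ^ (-σ / 2)) := by
        rw [h2]
        field_simp
    _ = ν ^ (1 - σ) * ∫ t : ℝ, (1 + t ^ 2) ^ (-σ / 2) := by
        rw [← mul_assoc, show ν * ν ^ (-σ) = ν ^ (1 - σ) by
          rw [sub_eq_add_neg, Real.rpow_add hν, Real.rpow_one]]

/-- `a ↦ (a² + p²)^{1 − σ/2}` is integrable on `ℝ` for `p > 0`, `σ > 3` (scaling of `(1 + t²)^{−(σ−2)/2}`). -/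
theorem integrable_sq_add_const_rpow {p : ℝ} (hp : 0 < p) {σ : ℝ} (hσ : 3 < σ) :
    Integrable (fun a : ℝ => (a ^ 2 + p ^ 2) ^ (1 - σ / 2)) := by
  have h2 : Integrable (fun t : ℝ => (fun a : ℝ => (a ^ 2 + p ^ 2) ^ (1 - σ / 2)) (p * t)) := by
    have h3 : (fun t : ℝ => (fun a : ℝ => (a ^ 2 + p ^ 2) ^ (1 - σ / 2)) (p * t)) =
        fun t => (p ^ 2) ^ (1 - σ / 2) * (1 + t ^ 2) ^ (-(σ - 2) / 2) := by
      funext t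
      simp only []
      rw [show (p * t) ^ 2 + p ^ 2 = p ^ 2 * (1 + t ^ 2) by ring, Real.mul_rpow (by positivity) (by positivity),
        show (1 - σ / 2 : ℝ) = -(σ - 2) / 2 by ring]
    rw [h3]
    exact (integrable_one_add_sq_rpow (by linarith : 1 < σ - 2)).const_mul _
  exact (integrable_comp_mul_left_iff (fun a : ℝ => (a ^ 2 + p ^ 2) ^ (1 - σ / 2)) hp.ne').mp h2

/-! ## Two-dimensional translation–scaling lemmas (`ℂ ≅ ℝ²`, `finrank ℝ ℂ = 2`) -/

/-- `u ↦ (1 + ‖u‖²)^{1−σ}` is integrable on `ℂ` for `σ > 2` (so `C₂(σ) = ∫_ℂ (1+‖u‖²)^{1−σ} du` is finite). -/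
theorem integrable_one_add_norm_sq_rpow_complex {σ : ℝ} (hσ : 2 < σ) :
    Integrable (fun u : ℂ => (1 + ‖u‖ ^ 2) ^ (1 - σ)) := by
  have h := integrable_rpow_neg_one_add_norm_sq (E := ℂ) (μ := volume) (r := 2 * σ - 2) (by
    rw [Complex.finrank_real_complex]
    push_cast
    linarith)
  refine h.congr (Filter.Eventually.of_forall fun u => ?_)
  simp only []
  congr 1
  ring

/-- Scaling in `ℂ`: with `R = √(K/p)`, `(p‖R • u‖² + K)^{1−σ} = K^{1−σ} (1 + ‖u‖²)^{1−σ}`. -/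
theorem mul_norm_smul_sq_add_rpow {p K : ℝ} (hp : 0 < p) (hK : 0 < K) (σ : ℝ) (u : ℂ) :
    (p * ‖Real.sqrt (K / p) • u‖ ^ 2 + K) ^ (1 - σ) = K ^ (1 - σ) * (1 + ‖u‖ ^ 2) ^ (1 - σ) := by
  have hR2 : Real.sqrt (K / p) ^ 2 = K / p := Real.sq_sqrt (div_pos hK hp).le
  rw [norm_smul, Real.norm_of_nonneg (Real.sqrt_nonneg _), mul_pow, hR2,
    show p * (K / p * ‖u‖ ^ 2) + K = K * (1 + ‖u‖ ^ 2) by field_simp; ring, Real.mul_rpow hK.le (by positivity)]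

/-- `z ↦ (p‖z − c₀‖² + K)^{1−σ}` is integrable on `ℂ` for `p, K > 0`, `σ > 2`. -/
theorem integrable_mul_norm_sub_sq_add_rpow {p K : ℝ} (hp : 0 < p) (hK : 0 < K) {σ : ℝ} (hσ : 2 < σ) (c₀ : ℂ) :
    Integrable (fun z : ℂ => (p * ‖z - c₀‖ ^ 2 + K) ^ (1 - σ)) := by
  have hR : Real.sqrt (K / p) ≠ 0 := (Real.sqrt_pos.mpr (div_pos hK hp)).ne'
  have h1 : Integrable (fun z : ℂ => (p * ‖z‖ ^ 2 + K) ^ (1 - σ)) := by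
    have h2 : Integrable (fun u : ℂ => (fun z : ℂ => (p * ‖z‖ ^ 2 + K) ^ (1 - σ)) (Real.sqrt (K / p) • u)) := by
      have h3 : (fun u : ℂ => (fun z : ℂ => (p * ‖z‖ ^ 2 + K) ^ (1 - σ)) (Real.sqrt (K / p) • u)) =
          fun u => K ^ (1 - σ) * (1 + ‖u‖ ^ 2) ^ (1 - σ) := funext fun u => mul_norm_smul_sq_add_rpow hp hK σ u
      rw [h3]
      exact (integrable_one_add_norm_sq_rpow_complex hσ).const_mul _
    exact (integrable_comp_smul_iff volume (fun z : ℂ => (p * ‖z‖ ^ 2 + K) ^ (1 - σ)) hR).mp h2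
  exact h1.comp_sub_right c₀

/-- Translation + scaling in `ℂ`: `∫_ℂ (p‖z − c₀‖² + K)^{1−σ} dz = K^{1−σ} · (K/p) · ∫_ℂ (1 + ‖u‖²)^{1−σ} du` (`p, K > 0`). -/
theorem integral_mul_norm_sub_sq_add_rpow {p K : ℝ} (hp : 0 < p) (hK : 0 < K) (σ : ℝ) (c₀ : ℂ) :
    ∫ z : ℂ, (p * ‖z - c₀‖ ^ 2 + K) ^ (1 - σ) = K ^ (1 - σ) * (K / p) * ∫ u : ℂ, (1 + ‖u‖ ^ 2) ^ (1 - σ) := by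
  have h1 : ∫ z : ℂ, (p * ‖z - c₀‖ ^ 2 + K) ^ (1 - σ) = ∫ z : ℂ, (p * ‖z‖ ^ 2 + K) ^ (1 - σ) :=
    integral_sub_right_eq_self (fun z => (p * ‖z‖ ^ 2 + K) ^ (1 - σ)) c₀
  have hKp : 0 < K / p := div_pos hK hp
  have hR2 : Real.sqrt (K / p) ^ 2 = K / p := Real.sq_sqrt hKp.le
  have h2 := Measure.integral_comp_smul (volume : Measure ℂ) (fun z : ℂ => (p * ‖z‖ ^ 2 + K) ^ (1 - σ)) (Real.sqrt (K / p))
  rw [Complex.finrank_real_complex] at h2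
  have h3 : (fun u : ℂ => (fun z : ℂ => (p * ‖z‖ ^ 2 + K) ^ (1 - σ)) (Real.sqrt (K / p) • u)) =
      fun u => K ^ (1 - σ) * (1 + ‖u‖ ^ 2) ^ (1 - σ) := funext fun u => mul_norm_smul_sq_add_rpow hp hK σ u
  rw [h3, integral_const_mul, hR2, abs_of_pos (by positivity), smul_eq_mul] at h2
  rw [h1]
  have hKp0 : K / p ≠ 0 := hKp.ne'
  calc ∫ z : ℂ, (p * ‖z‖ ^ 2 + K) ^ (1 - σ)
        = (K / p) * (K ^ (1 - σ) * ∫ u : ℂ, (1 + ‖u‖ ^ 2) ^ (1 - σ)) := by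
          rw [h2]
          field_simp
    _ = K ^ (1 - σ) * (K / p) * ∫ u : ℂ, (1 + ‖u‖ ^ 2) ^ (1 - σ) := by ring

/-! ## The determinant `det(g + ix)` in the chart and the key identity -/

/-- `det(g + ix) = (det g − det x) + i·(pb + qa − 2 Re(w z̄))` for `g = [[p, w],[w̄, q]]`, `x = [[a, z],[z̄, b]]`. -/
theorem det_hermTwo_add_I_smul_hermTwo (d c : ℝ × ℂ × ℝ) :
    (hermTwo d + I • hermTwo c).det =
      ((d.1 * d.2.2 - normSq d.2.1 - (c.1 * c.2.2 - normSq c.2.1) : ℝ) : ℂ) +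
        ((d.1 * c.2.2 + d.2.2 * c.1 - 2 * (d.2.1 * conj c.2.1).re : ℝ) : ℂ) * I := by
  rw [Matrix.det_fin_two]
  simp only [Matrix.add_apply, Matrix.smul_apply, smul_eq_mul, hermTwo_apply_zero_zero, hermTwo_apply_zero_one,
    hermTwo_apply_one_zero, hermTwo_apply_one_one]
  apply Complex.ext
  · simp [normSq_apply]
    ring
  · simp [normSq_apply]
    ring

/-- `|det(g + ix)|² = (det g − det x)² + (pb + qa − 2 Re(w z̄))²`. -/
theorem normSq_det_hermTwo_add_I_smul_hermTwo (d c : ℝ × ℂ × ℝ) :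
    normSq ((hermTwo d + I • hermTwo c).det) =
      (d.1 * d.2.2 - normSq d.2.1 - (c.1 * c.2.2 - normSq c.2.1)) ^ 2 +
        (d.1 * c.2.2 + d.2.2 * c.1 - 2 * (d.2.1 * conj c.2.1).re) ^ 2 := by
  rw [det_hermTwo_add_I_smul_hermTwo, normSq_add_mul_I]

/-- `det(g − ix)` is the complex conjugate of `det(g + ix)`. -/
theorem det_hermTwo_sub_I_smul_hermTwo (d c : ℝ × ℂ × ℝ) :
    (hermTwo d - I • hermTwo c).det = conj ((hermTwo d + I • hermTwo c).det) := by
  have h : hermTwo d - I • hermTwo c = hermTwo d + I • hermTwo (-c.1, -c.2.1, -c.2.2) := by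
    ext i j
    fin_cases i <;> fin_cases j <;> simp [hermTwo] <;> ring
  rw [h, det_hermTwo_add_I_smul_hermTwo, det_hermTwo_add_I_smul_hermTwo]
  simp only [map_add, map_mul, conj_ofReal, conj_I, map_neg, normSq_neg, mul_neg, neg_mul, Complex.neg_re]
  push_cast
  ring

/-! ## The key identity `|det(g + ix)|² = (a² + p²)((b + μ)² + ν²)` -/

section KeyIdentity

variable {p q : ℝ} {w : ℂ}

/-- THE KEY IDENTITY (Lagrange): as a function of `b`, `|det(g + ix)|²` is the quadratic `(a² + p²)((b + μ)² + ν²)` with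
`μ = (p(qa − 2Re(w z̄)) − a(det g + |z|²))/(a²+p²)` and `ν = (p‖z − (a/p)w‖² + (a²+p²) det g/p)/(a²+p²)`. -/
theorem normSq_det_eq_quadratic (hp : 0 < p) (a : ℝ) (z : ℂ) (b : ℝ) :
    normSq ((hermTwo (p, w, q) + I • hermTwo (a, z, b)).det) =
      (a ^ 2 + p ^ 2) *
        ((b + (p * (q * a - 2 * (w * conj z).re) - a * (p * q - normSq w + normSq z)) / (a ^ 2 + p ^ 2)) ^ 2 +
          ((p * ‖z - ((a / p : ℝ) : ℂ) * w‖ ^ 2 + (a ^ 2 + p ^ 2) * (p * q - normSq w) / p) / (a ^ 2 + p ^ 2)) ^ 2) := by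
  rw [normSq_det_hermTwo_add_I_smul_hermTwo, Complex.sq_norm, normSq_apply, normSq_apply, normSq_apply]
  have hp0 : p ≠ 0 := hp.ne'
  have hap : a ^ 2 + p ^ 2 ≠ 0 := by positivity
  simp only [sub_re, sub_im, mul_re, mul_im, ofReal_re, ofReal_im, conj_re, conj_im]
  field_simp
  ring

/-- `ν > 0`. -/
theorem nu_pos (hp : 0 < p) (hpq : normSq w < p * q) (a : ℝ) (z : ℂ) :
    0 < (p * ‖z - ((a / p : ℝ) : ℂ) * w‖ ^ 2 + (a ^ 2 + p ^ 2) * (p * q - normSq w) / p) / (a ^ 2 + p ^ 2) := by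
  have h1 : 0 < (a ^ 2 + p ^ 2) * (p * q - normSq w) / p := by
    apply div_pos _ hp
    exact mul_pos (by positivity) (by linarith)
  have h2 : 0 ≤ p * ‖z - ((a / p : ℝ) : ℂ) * w‖ ^ 2 := by positivity
  exact div_pos (by linarith) (by positivity)

/-- The kernel in the chart: `‖det(g + ix)‖^{−σ} = ((a² + p²)((b + μ)² + ν²))^{−σ/2}`. -/
theorem norm_det_rpow_neg_eq (hp : 0 < p) (σ a : ℝ) (z : ℂ) (b : ℝ) :
    ‖(hermTwo (p, w, q) + I • hermTwo (a, z, b)).det‖ ^ (-σ) =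
      ((a ^ 2 + p ^ 2) *
        ((b + (p * (q * a - 2 * (w * conj z).re) - a * (p * q - normSq w + normSq z)) / (a ^ 2 + p ^ 2)) ^ 2 +
          ((p * ‖z - ((a / p : ℝ) : ℂ) * w‖ ^ 2 + (a ^ 2 + p ^ 2) * (p * q - normSq w) / p) / (a ^ 2 + p ^ 2)) ^ 2)) ^ (-σ / 2) := by
  rw [← normSq_det_eq_quadratic hp a z b, ← Complex.sq_norm, show ((‖(hermTwo (p, w, q) + I • hermTwo (a, z, b)).det‖ ^ 2 : ℝ)) =
      ‖(hermTwo (p, w, q) + I • hermTwo (a, z, b)).det‖ ^ (2 : ℝ) by norm_cast, ← Real.rpow_mul (norm_nonneg _)]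
  congr 1
  ring

end KeyIdentity

end Summit.HodgeConjecture.HodgeConjecture.Cruxes.HLiu418.K2LiuHermTwoDetPowerFibres

end
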